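import Mathlib
import HarnessLib
import Summits.CriticalPhenomena.CardyFormulaZ2.Theses.CardyQContinuation

/-!
# `PivotalCancellationAtOne` (route CardyQContinuation, item stmt-CriticalPhenomena-7129): reductions

The item says that for every conformal rectangle the ratio
`P′_δ(1) / P^perc′_δ(1)` of the first `s`-jet of the self-dual random-cluster crossing ratio
`P_δ = N_δ/Z_δ` at `s = 1` to the first `t`-jet of the Bernoulli crossing ratio
`P^perc_δ(t) = Σ_C t^|ω| / Σ t^|ω|` at `t = 1` tends to `0` as `δ → 0⁺`.

This file records the structural reduction used by the route's card
(q-derivative-alpha4-stress-mode): the item follows from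

* `FirstJetAtOneBounded` (item stmt-CriticalPhenomena-7102): `‖P′_δ(1)‖ ≤ M` eventually, and
* divergence of the Bernoulli jet `‖P^perc′_δ(1)‖ → ∞` (Russo: `P^perc′_δ(1) = E_{1/2} N_piv / 4`,
  and the expected number of pivotal edges of a macroscopic crossing diverges at criticality).
-/

namespace Summit.CriticalPhenomena.CardyFormulaZ2.Theorems

open Filter Topology
open Summit.CriticalPhenomena.CardyFormulaZ2.Theses.CardyQContinuation

/-- Squeeze: a family that is eventually bounded in norm, divided by a family whose norm tends
to infinity, tends to `0` (in any normed division ring; junk-safe since `x / 0 = 0` has norm `0`).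
[folklore] -/
theorem tendsto_div_nhds_zero_of_eventually_norm_le_of_tendsto_norm_atTop
    {α 𝕜 : Type*} [NormedDivisionRing 𝕜] {l : Filter α} {f g : α → 𝕜} (M : ℝ)
    (hf : ∀ᶠ x in l, ‖f x‖ ≤ M) (hg : Tendsto (fun x ↦ ‖g x‖) l atTop) :
    Tendsto (fun x ↦ f x / g x) l (𝓝 0) := by
  have h1 : Tendsto (fun x ↦ ‖g x‖⁻¹) l (𝓝 0) := hg.inv_tendsto_atTop
  have h2 : Tendsto (fun x ↦ |M| * ‖g x‖⁻¹) l (𝓝 0) := by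
    simpa using h1.const_mul |M|
  refine squeeze_zero_norm' ?_ h2
  filter_upwards [hf] with x hx
  rw [norm_div, div_eq_mul_inv]
  gcongr
  exact hx.trans (le_abs_self M)

/-- **Reduction of item stmt-CriticalPhenomena-7129 to item stmt-CriticalPhenomena-7102 plus
divergence of the Bernoulli jet.** If the first `s`-jet of the self-dual crossing ratio at `s = 1`
stays bounded as `δ → 0⁺` for every conformal rectangle (`FirstJetAtOneBounded`), and the first
`t`-jet at `t = 1` of the Bernoulli crossing ratio `P^perc_δ(t) = Σ_{ω ∈ C} t^|ω| / Σ_ω t^|ω|`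
(sums over `ω ⊆ E(Ω_δ)`; by Russo's formula this jet is `E_{1/2}[N_piv]/4`) diverges in norm for
every conformal rectangle, then `PivotalCancellationAtOne` holds. [folklore] -/
theorem pivotalCancellationAtOne_of_firstJetAtOneBounded_of_tendsto_atTop
    (hB : FirstJetAtOneBounded)
    (hdiv : ∀ R : Literature.Probability.RandomPlanarGeometry.ConformalRectangle,
      Tendsto (fun δ : ℝ ↦ ‖deriv (fun t : ℂ ↦ (∑ᶠ ω ∈ 𝒫
        (Literature.Probability.LatticeModels.discreteDomainGraph R.carrier δ).edgeSet,
        (Literature.Probability.Percolation.discreteCrossing R.carrier δ (R.arc 0)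
          (R.arc 2)).indicator (fun ω ↦ t ^ ω.ncard) ω) / (∑ᶠ ω ∈ 𝒫
        (Literature.Probability.LatticeModels.discreteDomainGraph R.carrier δ).edgeSet,
        t ^ ω.ncard)) 1‖) (𝓝[>] 0) atTop) :
    PivotalCancellationAtOne := by
  intro R
  obtain ⟨M, hM⟩ := hB R
  exact tendsto_div_nhds_zero_of_eventually_norm_le_of_tendsto_norm_atTop M hM (hdiv R)

end Summit.CriticalPhenomena.CardyFormulaZ2.Theorems
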